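import Summits.CriticalPhenomena.PercolationContinuityZ3.Theorems.PercNearOneGluingNoHeavyLowerTailFrontierDecRowsUnmarkedEdgeSymmetry
import HarnessLib

/-!
# The PINNED-TERMINAL induction schema: a decreasing pattern row on every finite weighted graph from the
# (terminal, unmarked) five-point edge forms AT ONE CHOSEN TERMINAL — any terminal that is a singleton side of some event

Support file (prover seat `prim-l12-p6`, gen 4; `--supports stmt-CriticalPhenomena-4575`).  No named facts, no sorries, no `native_decide`;
bookkeeping definitions `TouchAt`, `IsPinnedAt`, `PinnedPat`.  Sequel of `…FrontierDecRowsUnmarkedEdgeSymmetry` (prim-bnk-1 gen 8).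

WHY.  `TerminalEdgeInduction.sahiE3_pev_nonneg_of_unmarkedEdgeHyp` (bnk-1) needs the polarised Bernstein forms `B₁, B₂ ≥ 0` at the
(terminal, unmarked) edges of EVERY terminal, because its induction expands an arbitrary fractional edge touching the weight-one component of
SOME terminal; only a symmetry of the row lets one drop terminal types (`frontier_44_all_of_at0`; PATH still needs hub AND leaf,
`frontier_36_all_of_at0_at2`).  Here the induction is steered: expand only edges touching the weight-one component of ONE fixed terminal
`x i₀`.  If no fractional edge touches it, the open cluster of `x i₀` is almost surely its weight-one component, so every event PINNED at
`i₀` — one whose membership only depends on which terminals `x i₀` is joined to, e.g. `D[{x i₀}|Y]` or `D[X|{x i₀}]` — is almost surely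
constant; then `E₃(E₁,E₂,E₃)` with `E₁` pinned is either `0` (`E₁ = ∅` a.s.) or `E₃(Ω,E₂,E₃) = μ(E₂∩E₃) − μ(E₂)μ(E₃)`, which is `≥ 0` for
positively correlated `E₂, E₃` (Harris, for decreasing rows).  So:

**Theorem (`sahiE3_pev_nonneg_of_unmarkedEdgeHypAt`).**  For three `k`-terminal pattern predicates `Φ₁ Φ₂ Φ₃` with `Φ₁` pinned at `i₀`
(`PinnedPat i₀ Φ₁`: `Φ₁` only reads row/column `i₀` of the connectivity matrix) and `pev Φ₂ x, pev Φ₃ x` positively correlated under every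
`prodBernoulli`, the unmarked-edge hypotheses AT THE SINGLE TERMINAL `i₀` (`UnmarkedEdgeHypAt i₀`, for every number of vertices) give
`0 ≤ E₃(pev Φ₁ x, pev Φ₂ x, pev Φ₃ x)` at every injective marking of every finite weighted graph.
Group-separation form `sahiE3_sep_nonneg_of_unmarkedEdgeHypAt`: three decreasing separations `D[Xⱼ|Yⱼ]` of sub-lists of the terminals, one of
the six sides being the singleton `[i₀]` (any slot, either side; Harris supplies the correlation, `sahiE3_comm₁₂/₂₃` + `polar₁` symmetry move
the pinned slot).

CONSEQUENCES for the seven open four-point rows of `…FrontierDecRowsLeFive` (each for ALL `n`, from ONE family of five-point cubic forms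
`B₁(t,u), B₂(t,u) ≥ 0`, `u` unmarked, induction-hypothesis rows admissible; choose the terminal type):
* PATH (36) `(D[a|b], D[a|c], D[b|y])`: every terminal is pinned — `frontier_36_all_of_at (i₀ : Fin 4)`: the forms at ANY ONE of `a, b, c, y`
  suffice (all markings; bnk-1 needed hub + leaf);
* row 12 `(D[ab|c], D[ac|by], D[b|y])`: `b`, `c` or `y` (`frontier_12_of_at`);  row 15 `(D[ab|c], D[ac|y], D[b|y])`: `b`, `c` or `y`;
  row 27 `(D[ab|c], D[ab|y], D[ac|by])`: `c` or `y`;  row 30 `(D[ab|c], D[ac|by], D[b|cy])`: `b` or `c`;  row 37 `(D[ab|c], D[ac|y], D[ay|b])`: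
  `b`, `c` or `y`;  row 44: any (bnk-1's `frontier_44_all_of_at0` already).
The census of the pieces per edge type (ttrl cp-hms, run/shared/lean/ttrl/hms/BERNSTEIN-PIECES.md Table A) says which type is the roomy one:
row 30 at `b`/`c` and row 37 at `b` have `min B₁/(B₀+B₃) ≈ 0.28 / 0.18` (no exact zeros), whereas e.g. row 27's pinned types `c, y` carry the
endpoint-zero locus — so this file turns "which five-point certificate to hunt" into a one-type question per row.
PROOF of the schema = bnk-1's induction on the number of fractional edges under the invariant `HasSpare` (every terminal has a non-terminal in
its weight-one component), with at most THREE re-markings per step (free the touched vertex `z` if it is another terminal's position by moving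
that terminal to its spare; move `i₀` to `z`; move the far end `u` off the terminals), then pendant clones one dimension up (`sahiE3_clone`,
`hasSpare_clone`) remove the invariant.
-/

noncomputable section

namespace Summit.CriticalPhenomena.PercolationContinuityZ3.Theorems

namespace TerminalEdgeInduction

open MeasureTheory Literature.Probability.Percolation Literature.Probability.LatticeModels
open EdgeInduction CovTransferCert E3GroupSepCert
open scoped Classical

variable {n k : ℕ}

/-! ### Fractional edges touching the weight-one component of ONE terminal -/

/-- "Some fractional edge touches the weight-one component of the terminal `x i₀`". [this work] -/
def TouchAt (w : Sym2 (Fin n) → unitInterval) (x : Fin k → Fin n) (i₀ : Fin k) : Prop :=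
  ∃ z u : Fin n, (openGraph (oneCfg w)).Reachable (x i₀) z ∧ z ≠ u ∧ (0 : ℝ) < w s(z, u) ∧ (w s(z, u) : ℝ) < 1

/-- If no fractional edge touches the weight-one component of `x i₀`, then almost surely (on `good w`) the open cluster of `x i₀` IS its
weight-one component. [this work] -/
theorem reachable_iff_of_not_touchAt {w : Sym2 (Fin n) → unitInterval} {x : Fin k → Fin n} {i₀ : Fin k} (hB : ¬ TouchAt w x i₀)
    {ω : BondConfig (Fin n)} (hω : ω ∈ good w) (v : Fin n) :
    (openGraph ω).Reachable (x i₀) v ↔ (openGraph (oneCfg w)).Reachable (x i₀) v := by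
  refine ⟨fun h => ?_, reachable_of_good hω⟩
  rw [SimpleGraph.reachable_iff_reflTransGen] at h
  induction h with
  | refl => exact SimpleGraph.Reachable.refl _
  | @tail b c _ hbc ih =>
      rw [openGraph_adj] at hbc
      obtain ⟨hmem, hne⟩ := hbc
      rcases weight_trichotomy w s(b, c) with h0 | h1 | hf
      · exact absurd hmem ((hω _).2 h0)
      · refine ih.trans (SimpleGraph.Adj.reachable ?_)
        rw [openGraph_adj]
        exact ⟨h1, hne⟩
      · exact absurd ⟨b, c, ih, hne, hf⟩ hB

/-! ### Events pinned at a terminal -/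

/-- A marking-indexed family `E` is PINNED at the terminal `i₀` if membership `ω ∈ E x` only depends on which terminals `x i₀` is joined
to in `ω` (e.g. `D[{x i₀}|Y]`, `D[X|{x i₀}]`). [this work] -/
def IsPinnedAt (i₀ : Fin k) (E : (Fin k → Fin n) → Set (BondConfig (Fin n))) : Prop :=
  ∀ ⦃ω ω' : BondConfig (Fin n)⦄ ⦃x : Fin k → Fin n⦄,
    (∀ j, (ω ∈ openConn (x i₀) (x j) ↔ ω' ∈ openConn (x i₀) (x j))) → (ω ∈ E x ↔ ω' ∈ E x)

/-- A pattern predicate is PINNED at `i₀` if it only reads row `i₀` and column `i₀` of the connectivity matrix. [this work] -/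
def PinnedPat (i₀ : Fin k) (Φ : (Fin k → Fin k → Bool) → Bool) : Prop :=
  ∀ M M' : Fin k → Fin k → Bool, (∀ j, M i₀ j = M' i₀ j) → (∀ j, M j i₀ = M' j i₀) → Φ M = Φ M'

/-- The event of a pinned pattern predicate is a pinned family. [this work] -/
theorem isPinnedAt_pev {i₀ : Fin k} {Φ : (Fin k → Fin k → Bool) → Bool} (hΦ : PinnedPat i₀ Φ) :
    IsPinnedAt i₀ (fun x : Fin k → Fin n => pev Φ x) := by
  intro ω ω' x h
  simp only [mem_pev_iff]
  have hs : ∀ (ξ : BondConfig (Fin n)) (p q : Fin n), ξ ∈ openConn p q ↔ ξ ∈ openConn q p :=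
    fun ξ p q => ⟨fun h' => SimpleGraph.Reachable.symm h', fun h' => SimpleGraph.Reachable.symm h'⟩
  rw [hΦ (fun i j => decide (ω ∈ openConn (x i) (x j))) (fun i j => decide (ω' ∈ openConn (x i) (x j)))
    (fun j => Bool.decide_congr (h j)) (fun j => Bool.decide_congr (by rw [hs ω, hs ω']; exact h j))]

/-- `D[{i₀}|J]` is pinned at `i₀`. [this work] -/
theorem pinnedPat_sepPat_left (i₀ : Fin k) (J : List (Fin k)) : PinnedPat i₀ (sepPat [i₀] J) := by
  intro M M' hr _
  simp only [sepPat, List.all_cons, List.all_nil, Bool.and_true]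
  congr 1
  funext j
  rw [hr j]

/-- `D[I|{i₀}]` is pinned at `i₀`. [this work] -/
theorem pinnedPat_sepPat_right (i₀ : Fin k) (I : List (Fin k)) : PinnedPat i₀ (sepPat I [i₀]) := by
  intro M M' _ hc
  simp only [sepPat, List.all_cons, List.all_nil, Bool.and_true]
  congr 1
  funext i
  rw [hc i]

/-! ### `E₃` with an almost surely constant first slot -/

/-- `E₃(Ω, B, C) = μ(B ∩ C) − μ(B)μ(C)` (probability measure), up to a null modification of the first slot. [folklore] -/
theorem sahiE3_of_ae_univ {μ : Measure (BondConfig (Fin n))} [IsProbabilityMeasure μ] {A B C : Set (BondConfig (Fin n))}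
    (hA : A =ᵐ[μ] (Set.univ : Set (BondConfig (Fin n)))) :
    sahiE3 μ A B C = μ.real (B ∩ C) - μ.real B * μ.real C := by
  rw [sahiE3_congr_ae hA (Filter.EventuallyEq.refl _ B) (Filter.EventuallyEq.refl _ C)]
  simp only [sahiE3, Set.univ_inter, probReal_univ]
  ring

/-- `E₃(∅, B, C) = 0`, up to a null modification of the first slot. [folklore] -/
theorem sahiE3_of_ae_empty {μ : Measure (BondConfig (Fin n))} [IsProbabilityMeasure μ] {A B C : Set (BondConfig (Fin n))}
    (hA : A =ᵐ[μ] (∅ : Set (BondConfig (Fin n)))) : sahiE3 μ A B C = 0 := by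
  rw [sahiE3_congr_ae hA (Filter.EventuallyEq.refl _ B) (Filter.EventuallyEq.refl _ C)]
  simp [sahiE3]

variable {E₁ E₂ E₃ : (Fin k → Fin n) → Set (BondConfig (Fin n))}

/-- **Deterministic case at one terminal.**  If no fractional edge touches the weight-one component of `x i₀`, an event pinned at `i₀`
is almost surely constant, so `E₃(E₁ x, E₂ x, E₃ x)` is `0` or `μ(E₂∩E₃) − μ(E₂)μ(E₃)`; in particular it is `≥ 0` when `E₂ x, E₃ x` are
positively correlated. [this work] -/
theorem sahiE3_nonneg_of_not_touchAt {i₀ : Fin k} (hP : IsPinnedAt i₀ E₁) (w : Sym2 (Fin n) → unitInterval) (x : Fin k → Fin n)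
    (hcov : (prodBernoulli w).real (E₂ x) * (prodBernoulli w).real (E₃ x) ≤ (prodBernoulli w).real (E₂ x ∩ E₃ x))
    (hB : ¬ TouchAt w x i₀) : 0 ≤ sahiE3 (prodBernoulli w) (E₁ x) (E₂ x) (E₃ x) := by
  have pat : ∀ᵐ ω ∂(prodBernoulli w), (ω ∈ E₁ x ↔ oneCfg w ∈ E₁ x) := by
    filter_upwards [ae_good w] with ω hω
    exact hP fun j => reachable_iff_of_not_touchAt hB hω (x j)
  by_cases h1 : oneCfg w ∈ E₁ x
  · have hA : E₁ x =ᵐ[prodBernoulli w] (Set.univ : Set (BondConfig (Fin n))) :=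
      Filter.eventuallyEq_set.2 (by filter_upwards [pat] with ω hω; simp [hω, h1])
    rw [sahiE3_of_ae_univ hA]
    linarith
  · have hA : E₁ x =ᵐ[prodBernoulli w] (∅ : Set (BondConfig (Fin n))) :=
      Filter.eventuallyEq_set.2 (by filter_upwards [pat] with ω hω; simp [hω, h1])
    rw [sahiE3_of_ae_empty hA]

/-! ### Re-marking toolkit under the invariant `HasSpare` -/

/-- One re-marking inside a weight-one component keeps injectivity, the spares and `E₃`. [bnk-1 gen 8, repackaged] -/
theorem remark_pack (hE₁ : IsLocal E₁) (hE₂ : IsLocal E₂) (hE₃ : IsLocal E₃) (w : Sym2 (Fin n) → unitInterval)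
    {x : Fin k → Fin n} (hx : Function.Injective x) (hs : HasSpare w x) (i : Fin k) {z : Fin n}
    (hz : (openGraph (oneCfg w)).Reachable (x i) z) (hzx : ∀ j, x j ≠ z) :
    Function.Injective (Function.update x i z) ∧ HasSpare w (Function.update x i z) ∧
      sahiE3 (prodBernoulli w) (E₁ (Function.update x i z)) (E₂ (Function.update x i z)) (E₃ (Function.update x i z)) =
        sahiE3 (prodBernoulli w) (E₁ x) (E₂ x) (E₃ x) :=
  ⟨injective_update_of_forall_ne hx hzx, hs.remark hx i hz hzx, sahiE3_remark hE₁ hE₂ hE₃ w x i z hz⟩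

/-- **Bring the terminal `i₀` onto a touched vertex.**  If `z` lies in the weight-one component of `x i₀`, there is an injective marking
`x'` with spares, `x' i₀ = z`, and the same `E₃` (if `z` is the position of another terminal, that terminal first moves to its spare).
[this work] -/
theorem exists_remark_onto (hE₁ : IsLocal E₁) (hE₂ : IsLocal E₂) (hE₃ : IsLocal E₃) (w : Sym2 (Fin n) → unitInterval)
    {x : Fin k → Fin n} (hx : Function.Injective x) (hs : HasSpare w x) (i₀ : Fin k) {z : Fin n}
    (hz : (openGraph (oneCfg w)).Reachable (x i₀) z) :
    ∃ x' : Fin k → Fin n, Function.Injective x' ∧ HasSpare w x' ∧ x' i₀ = z ∧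
      sahiE3 (prodBernoulli w) (E₁ x') (E₂ x') (E₃ x') = sahiE3 (prodBernoulli w) (E₁ x) (E₂ x) (E₃ x) := by
  by_cases hz0 : x i₀ = z
  · exact ⟨x, hx, hs, hz0, rfl⟩
  by_cases hzS : ∃ i', x i' = z
  · obtain ⟨i', rfl⟩ := hzS
    have hii : i' ≠ i₀ := fun h => hz0 (by rw [← h])
    obtain ⟨s', hs'r, hs'S⟩ := hs i'
    obtain ⟨hx', hs', hT⟩ := remark_pack hE₁ hE₂ hE₃ w hx hs i' hs'r hs'S
    have hfree : ∀ j, Function.update x i' s' j ≠ x i' := by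
      intro j
      by_cases hj : j = i'
      · subst hj; rw [Function.update_self]; exact (hs'S j).symm
      · rw [Function.update_of_ne hj]; exact fun h' => hj (hx h')
    have hz' : (openGraph (oneCfg w)).Reachable (Function.update x i' s' i₀) (x i') := by
      rw [Function.update_of_ne (Ne.symm hii)]; exact hz
    obtain ⟨hx'', hs'', hT'⟩ := remark_pack hE₁ hE₂ hE₃ w hx' hs' i₀ hz' hfree
    exact ⟨_, hx'', hs'', by rw [Function.update_self], by rw [hT', hT]⟩
  · have hzS' : ∀ i', x i' ≠ z := fun i' h' => hzS ⟨i', h'⟩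
    obtain ⟨hx', hs', hT⟩ := remark_pack hE₁ hE₂ hE₃ w hx hs i₀ hz hzS'
    exact ⟨_, hx', hs', by rw [Function.update_self], hT⟩

/-- **Move the far end off the terminals.**  If `u ≠ x i₀`, there is an injective marking `x'` with spares, `x' i₀ = x i₀`, `u` not a
terminal position, and the same `E₃` (if `u = x j`, the terminal `j` moves to its spare). [this work] -/
theorem exists_remark_off (hE₁ : IsLocal E₁) (hE₂ : IsLocal E₂) (hE₃ : IsLocal E₃) (w : Sym2 (Fin n) → unitInterval)
    {x : Fin k → Fin n} (hx : Function.Injective x) (hs : HasSpare w x) (i₀ : Fin k) {u : Fin n} (hu : x i₀ ≠ u) :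
    ∃ x' : Fin k → Fin n, Function.Injective x' ∧ HasSpare w x' ∧ x' i₀ = x i₀ ∧ (∀ j, x' j ≠ u) ∧
      sahiE3 (prodBernoulli w) (E₁ x') (E₂ x') (E₃ x') = sahiE3 (prodBernoulli w) (E₁ x) (E₂ x) (E₃ x) := by
  by_cases huS : ∃ j, x j = u
  · obtain ⟨j, rfl⟩ := huS
    have hji : j ≠ i₀ := fun h => hu (by rw [h])
    obtain ⟨sj, hsjr, hsjS⟩ := hs j
    obtain ⟨hx', hs', hT⟩ := remark_pack hE₁ hE₂ hE₃ w hx hs j hsjr hsjS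
    refine ⟨_, hx', hs', by rw [Function.update_of_ne (Ne.symm hji)], fun l => ?_, hT⟩
    by_cases hl : l = j
    · subst hl; rw [Function.update_self]; exact (hsjS l).symm
    · rw [Function.update_of_ne hl]; exact fun h' => hl (hx h')
  · exact ⟨x, hx, hs, rfl, fun j h' => huS ⟨j, h'⟩, rfl⟩

/-! ### The pinned schema under the invariant -/

/-- **The pinned-terminal schema under the invariant `HasSpare`.**  For local families with `E₁` pinned at `i₀` and `E₂ x, E₃ x` positively
correlated under every `prodBernoulli`, the unmarked-edge hypotheses at the single terminal `i₀` give `0 ≤ E₃(E₁ x, E₂ x, E₃ x)` for every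
`w` and every injective marking `x` with spares.  Induction on the number of fractional edges: a fractional edge `zu` with `z` in the
weight-one component of `x i₀` becomes, after at most three re-markings, an edge from the terminal `i₀` to an unmarked vertex, where the
Bernstein expansion, the induction hypotheses and `UnmarkedEdgeHypAt i₀` apply; if there is none, `sahiE3_nonneg_of_not_touchAt`. [this work] -/
theorem sahiE3_nonneg_of_unmarkedEdgeHypAt_of_hasSpare {i₀ : Fin k} (hE₁ : IsLocal E₁) (hE₂ : IsLocal E₂) (hE₃ : IsLocal E₃)
    (hP : IsPinnedAt i₀ E₁)
    (hcov : ∀ (w : Sym2 (Fin n) → unitInterval) (x : Fin k → Fin n),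
      (prodBernoulli w).real (E₂ x) * (prodBernoulli w).real (E₃ x) ≤ (prodBernoulli w).real (E₂ x ∩ E₃ x))
    (h : UnmarkedEdgeHypAt i₀ E₁ E₂ E₃) (w : Sym2 (Fin n) → unitInterval) (x : Fin k → Fin n) (hx : Function.Injective x)
    (hs : HasSpare w x) : 0 ≤ sahiE3 (prodBernoulli w) (E₁ x) (E₂ x) (E₃ x) := by
  suffices H : ∀ (m : ℕ) (w : Sym2 (Fin n) → unitInterval), (frac w).card ≤ m →
      ∀ x : Fin k → Fin n, Function.Injective x → HasSpare w x → 0 ≤ sahiE3 (prodBernoulli w) (E₁ x) (E₂ x) (E₃ x) from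
    H _ w le_rfl x hx hs
  intro m
  induction m with
  | zero =>
      intro w hm x hx _
      have hB : ¬ TouchAt w x i₀ := by
        rintro ⟨z, u, -, hzu, h0, h1⟩
        have := Finset.card_pos.2 ⟨_, mem_frac hzu h0 h1⟩
        omega
      exact sahiE3_nonneg_of_not_touchAt hP w x (hcov w x) hB
  | succ m ih =>
      intro w hm x hx hs
      -- the Bernstein step at a fractional edge from the terminal `i₀` to an UNMARKED vertex `u`
      have step : ∀ (x : Fin k → Fin n), Function.Injective x → HasSpare w x → ∀ (u : Fin n), (∀ l, x l ≠ u) →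
          (0 : ℝ) < w s(x i₀, u) → (w s(x i₀, u) : ℝ) < 1 → 0 ≤ sahiE3 (prodBernoulli w) (E₁ x) (E₂ x) (E₃ x) := by
        intro x hx hs u hu h0 h1
        have he : s(x i₀, u) ∈ frac w := mem_frac (hu i₀) h0 h1
        have hne1 : w s(x i₀, u) ≠ 1 := by
          intro h1'; rw [h1'] at h1; simp at h1
        have hc0 : (frac (Function.update w s(x i₀, u) 0)).card ≤ m :=
          Nat.lt_succ_iff.1 (lt_of_lt_of_le (card_frac_update_lt w he 0 (Or.inl rfl)) hm)
        have hc1 : (frac (Function.update w s(x i₀, u) 1)).card ≤ m :=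
          Nat.lt_succ_iff.1 (lt_of_lt_of_le (card_frac_update_lt w he 1 (Or.inr rfl)) hm)
        have i0 := ih _ hc0 x hx (hs.mono (oneCfg_subset_update hne1 0))
        have i1 := ih _ hc1 x hx (hs.mono (oneCfg_subset_update hne1 1))
        obtain ⟨b1, b2⟩ := h w x hx u hu i0 i1
        have hp0 : (0 : ℝ) ≤ w s(x i₀, u) := (w s(x i₀, u)).2.1
        have hp1 : (w s(x i₀, u) : ℝ) ≤ 1 := (w s(x i₀, u)).2.2
        have hq : (0 : ℝ) ≤ 1 - w s(x i₀, u) := sub_nonneg.2 hp1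
        rw [sahiE3_oneBond w s(x i₀, u) (E₁ x) (E₂ x) (E₃ x)]
        positivity
      by_cases hB : TouchAt w x i₀
      · obtain ⟨z, u, hiz, hzu, h0, h1⟩ := hB
        -- bring `i₀` onto `z`, then `u` off the terminals
        obtain ⟨x₁, hx₁, hs₁, hz₁, hT₁⟩ := exists_remark_onto hE₁ hE₂ hE₃ w hx hs i₀ hiz
        obtain ⟨x₂, hx₂, hs₂, hz₂, hu₂, hT₂⟩ := exists_remark_off hE₁ hE₂ hE₃ w hx₁ hs₁ i₀ (u := u) (by rw [hz₁]; exact hzu)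
        rw [← hT₁, ← hT₂]
        refine step x₂ hx₂ hs₂ u hu₂ ?_ ?_
        · rw [hz₂, hz₁]; exact h0
        · rw [hz₂, hz₁]; exact h1
      · exact sahiE3_nonneg_of_not_touchAt hP w x (hcov w x) hB

/-! ### The pinned schema, unconditionally (pendant clones) -/

/-- **THE PINNED-TERMINAL INDUCTION SCHEMA.**  For three `k`-terminal pattern predicates with `Φ₁` pinned at `i₀` and `pev Φ₂ x, pev Φ₃ x`
positively correlated under every `prodBernoulli` (e.g. both decreasing: Harris), if for EVERY number of vertices the polarised Bernstein
coefficients of `E₃` are nonnegative at every edge from THE terminal `i₀` to an unmarked vertex (given `E₃ ≥ 0` under the two updated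
weights; `UnmarkedEdgeHypAt i₀`), then `0 ≤ E₃` at every injective marking of every finite weighted graph. [this work] -/
theorem sahiE3_pev_nonneg_of_unmarkedEdgeHypAt (i₀ : Fin k) (Φ₁ Φ₂ Φ₃ : (Fin k → Fin k → Bool) → Bool) (hΦ : PinnedPat i₀ Φ₁)
    (hcov : ∀ (m : ℕ) (w : Sym2 (Fin m) → unitInterval) (x : Fin k → Fin m),
      (prodBernoulli w).real (pev Φ₂ x) * (prodBernoulli w).real (pev Φ₃ x) ≤ (prodBernoulli w).real (pev Φ₂ x ∩ pev Φ₃ x))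
    (h : ∀ m : ℕ, UnmarkedEdgeHypAt i₀ (fun x : Fin k → Fin m => pev Φ₁ x) (fun x => pev Φ₂ x) (fun x => pev Φ₃ x))
    (w : Sym2 (Fin n) → unitInterval) (x : Fin k → Fin n) (hx : Function.Injective x) :
    0 ≤ sahiE3 (prodBernoulli w) (pev Φ₁ x) (pev Φ₂ x) (pev Φ₃ x) := by
  rw [← sahiE3_clone w x Φ₁ Φ₂ Φ₃]
  exact sahiE3_nonneg_of_unmarkedEdgeHypAt_of_hasSpare (isLocal_pev Φ₁) (isLocal_pev Φ₂) (isLocal_pev Φ₃) (isPinnedAt_pev hΦ)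
    (hcov (n + k)) (h (n + k)) (cloneWeight w x) (Fin.castAdd k ∘ x) ((Fin.castAdd_injective n k).comp hx) (hasSpare_clone w x)

/-! ### Slot symmetries of the hypotheses at one terminal -/

/-- `polar₁ μ ν B A C = polar₁ μ ν A B C`. [folklore] -/
theorem polar₁_swap₁₂ (μ ν : Measure (BondConfig (Fin n))) (A B C : Set (BondConfig (Fin n))) :
    polar₁ μ ν B A C = polar₁ μ ν A B C := by
  unfold polar₁
  rw [Set.inter_comm B A]
  ring

/-- The hypotheses at one terminal are invariant under swapping the first two slots. [this work] -/
theorem UnmarkedEdgeHypAt.swap₁₂ {i₀ : Fin k} (h : UnmarkedEdgeHypAt i₀ E₁ E₂ E₃) : UnmarkedEdgeHypAt i₀ E₂ E₁ E₃ := by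
  intro w x hx u hu h0 h1
  rw [sahiE3_comm₁₂] at h0 h1
  have H := h w x hx u hu h0 h1
  rw [polar₁_swap₁₂ _ _ (E₂ x) (E₁ x) (E₃ x), polar₁_swap₁₂ _ _ (E₂ x) (E₁ x) (E₃ x)] at H
  exact H

/-- The hypotheses at one terminal are invariant under swapping the last two slots. [this work] -/
theorem UnmarkedEdgeHypAt.swap₂₃ {i₀ : Fin k} (h : UnmarkedEdgeHypAt i₀ E₁ E₂ E₃) : UnmarkedEdgeHypAt i₀ E₁ E₃ E₂ := by
  intro w x hx u hu h0 h1
  rw [← sahiE3_comm₂₃] at h0 h1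
  have H := h w x hx u hu h0 h1
  rw [← polar₁_swap₂₃ _ _ (E₁ x) (E₂ x) (E₃ x), ← polar₁_swap₂₃ _ _ (E₁ x) (E₂ x) (E₃ x)] at H
  exact H

/-! ### Group-separation rows: any slot, either side -/

/-- Harris for two group separations (both decreasing). [folklore] -/
theorem real_mul_le_inter_sep (w : Sym2 (Fin n) → unitInterval) (X Y X' Y' : List (Fin n)) :
    (prodBernoulli w).real (connEvent (sep X Y)) * (prodBernoulli w).real (connEvent (sep X' Y')) ≤
      (prodBernoulli w).real (connEvent (sep X Y) ∩ connEvent (sep X' Y')) :=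
  prodBernoulli_harris_lower w (isLowerSet_connEvent_sep X Y) (isLowerSet_connEvent_sep X' Y') (Set.toFinite _).measurableSet
    (Set.toFinite _).measurableSet

/-- The pinned schema for three group separations with the FIRST one pinned at `i₀` on its left (`I₁ = [i₀]`) or right (`J₁ = [i₀]`) side.
[this work] -/
theorem sahiE3_sep_nonneg_of_unmarkedEdgeHypAt_first (i₀ : Fin k) (I₁ J₁ I₂ J₂ I₃ J₃ : List (Fin k)) (hpin : I₁ = [i₀] ∨ J₁ = [i₀])
    (h : ∀ m : ℕ, UnmarkedEdgeHypAt i₀ (fun x : Fin k → Fin m => connEvent (sep (I₁.map x) (J₁.map x)))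
      (fun x => connEvent (sep (I₂.map x) (J₂.map x))) (fun x => connEvent (sep (I₃.map x) (J₃.map x))))
    (w : Sym2 (Fin n) → unitInterval) (x : Fin k → Fin n) (hx : Function.Injective x) :
    0 ≤ sahiE3 (prodBernoulli w) (connEvent (sep (I₁.map x) (J₁.map x))) (connEvent (sep (I₂.map x) (J₂.map x)))
      (connEvent (sep (I₃.map x) (J₃.map x))) := by
  have e : ∀ (m : ℕ) (I J : List (Fin k)), (fun x : Fin k → Fin m => connEvent (sep (I.map x) (J.map x))) = fun x => pev (sepPat I J) x :=
    fun m I J => funext fun x => (pev_sepPat I J x).symm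
  have hΦ : PinnedPat i₀ (sepPat I₁ J₁) := by
    rcases hpin with rfl | rfl
    · exact pinnedPat_sepPat_left i₀ J₁
    · exact pinnedPat_sepPat_right i₀ I₁
  rw [← pev_sepPat, ← pev_sepPat, ← pev_sepPat]
  refine sahiE3_pev_nonneg_of_unmarkedEdgeHypAt i₀ _ _ _ hΦ (fun m w' x' => ?_) (fun m => ?_) w x hx
  · rw [pev_sepPat, pev_sepPat]; exact real_mul_le_inter_sep w' _ _ _ _
  · rw [← e m I₁ J₁, ← e m I₂ J₂, ← e m I₃ J₃]; exact h m

/-- **Group-separation rows, pinned at one terminal.**  For three group separations `D[X₁|Y₁], D[X₂|Y₂], D[X₃|Y₃]` of sub-lists of `k`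
terminals (index lists `Iⱼ, Jⱼ`) such that the terminal `i₀` ALONE is one of the six sides, the unmarked-edge hypotheses at `i₀` (for all
numbers of vertices) give `0 ≤ E₃` at every injective marking of every finite weighted graph. [this work] -/
theorem sahiE3_sep_nonneg_of_unmarkedEdgeHypAt (i₀ : Fin k) (I₁ J₁ I₂ J₂ I₃ J₃ : List (Fin k))
    (hpin : I₁ = [i₀] ∨ J₁ = [i₀] ∨ I₂ = [i₀] ∨ J₂ = [i₀] ∨ I₃ = [i₀] ∨ J₃ = [i₀])
    (h : ∀ m : ℕ, UnmarkedEdgeHypAt i₀ (fun x : Fin k → Fin m => connEvent (sep (I₁.map x) (J₁.map x)))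
      (fun x => connEvent (sep (I₂.map x) (J₂.map x))) (fun x => connEvent (sep (I₃.map x) (J₃.map x))))
    (w : Sym2 (Fin n) → unitInterval) (x : Fin k → Fin n) (hx : Function.Injective x) :
    0 ≤ sahiE3 (prodBernoulli w) (connEvent (sep (I₁.map x) (J₁.map x))) (connEvent (sep (I₂.map x) (J₂.map x)))
      (connEvent (sep (I₃.map x) (J₃.map x))) := by
  rcases hpin with h1 | h1 | h2 | h2 | h3 | h3
  · exact sahiE3_sep_nonneg_of_unmarkedEdgeHypAt_first i₀ I₁ J₁ I₂ J₂ I₃ J₃ (Or.inl h1) h w x hx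
  · exact sahiE3_sep_nonneg_of_unmarkedEdgeHypAt_first i₀ I₁ J₁ I₂ J₂ I₃ J₃ (Or.inr h1) h w x hx
  · rw [sahiE3_comm₁₂]
    exact sahiE3_sep_nonneg_of_unmarkedEdgeHypAt_first i₀ I₂ J₂ I₁ J₁ I₃ J₃ (Or.inl h2) (fun m => (h m).swap₁₂) w x hx
  · rw [sahiE3_comm₁₂]
    exact sahiE3_sep_nonneg_of_unmarkedEdgeHypAt_first i₀ I₂ J₂ I₁ J₁ I₃ J₃ (Or.inr h2) (fun m => (h m).swap₁₂) w x hx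
  · rw [sahiE3_comm₂₃, sahiE3_comm₁₂]
    exact sahiE3_sep_nonneg_of_unmarkedEdgeHypAt_first i₀ I₃ J₃ I₁ J₁ I₂ J₂ (Or.inl h3) (fun m => (h m).swap₂₃.swap₁₂) w x hx
  · rw [sahiE3_comm₂₃, sahiE3_comm₁₂]
    exact sahiE3_sep_nonneg_of_unmarkedEdgeHypAt_first i₀ I₃ J₃ I₁ J₁ I₂ J₂ (Or.inr h3) (fun m => (h m).swap₂₃.swap₁₂) w x hx

end TerminalEdgeInduction

end Summit.CriticalPhenomena.PercolationContinuityZ3.Theorems
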